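import Summits.BirchSwinnertonDyer.Rank1Residual.ManinAdditive.CharTwistTwoIsometry
import Summits.BirchSwinnertonDyer.Rank1Residual.O5.CongruenceNumberTwistPrime
import HarnessLib

/-!
# TWIN AT TWO, part 3: `congruenceNumber (f ⊗ χ) = congruenceNumber f` for `χ ∈ {χ₋₄, χ₈, χ₋₈}`
# at level `cond(χ)² ∣ N` — cell `bsd-f2-manin` (D-0131 (3) frontier: the Manin constant at additive
# primes), analytic lens (seat `-an`, g7, MEMO-an §51)

THEOREMS ONLY (no definition, no named fact, no `sorry`; nothing booked; no census number moved).
The `p = 2` companion of the O5 cell's `CongruenceNumberTwistPrime` (TWIN for all ODD `p`,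
`PrimeTwist.congruenceNumber_charTwist`, `congruenceNumber_twin_prime (hp2 : p ≠ 2)`).

## What

* **TWIN from an isometry (`congruenceNumber_charTwist_of_isometry`, §1).** For `m² ∣ N`, `χ`
  primitive quadratic mod `m` with `IsUnit (n : ZMod m) ↔ n` odd, IF the twist `R` is a Petersson
  isometry on `2`-depleted forms (`⟨R f, R x⟩ = ⟨f, x⟩` for `2`-depleted `f` and all `x`), THEN
  `congruenceNumber (R f) = congruenceNumber f` for every `2`-depleted `f`: `R` is `ℤ`-linear on
  `S = S_k(Γ₀(N); ℤ)`, maps `ℤf + (ℤf)^⊥` into `ℤRf + (ℤRf)^⊥`, and `R² ≡ id (mod (ℤf)^⊥)`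
  (`R(R f) = f`, `x − R(R x) ⊥ f`), so it induces a BIJECTION `S/(ℤf + (ℤf)^⊥) ≃ S/(ℤRf + (ℤRf)^⊥)`
  (ARS 2012 §2.1 (ii); the O5 proof, abstracted over the isometry).
* **TWIN at conductor `4` and `8` (§2):** `congruenceNumber_charTwist_four` (`16 ∣ N`, `χ₋₄`),
  `congruenceNumber_charTwist_eight` (`64 ∣ N`, `χ(5) = −1`: `χ₈`, `χ₋₈`), by the isometries of
  `CharTwistTwoIsometry`; `_of_isNewform0` versions (a newform of level `4 ∣ N` is `2`-depleted,
  O5 `PrimeTwist.cuspCoeff_eq_zero_of_prime_dvd_of_isNewform0` at `p = 2`).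
* The curve-level corollaries (twin pairs up to isogeny) and the PRIME-CONDUCTOR slices of E-desc-20
  `TwistPacketCongruenceInvariance` (`d ∈ {−1, ±2, p*}`, `cond(χ_d)² ∣ N`) are in
  `TwistPacketCongruenceInvarianceSlices.lean`.

## What this does NOT do

No Manin-constant statement, no claim on the non-commuting orbits (E-an-35/36); refuter-1 §R32's
invertibility caveat concerns a different (newform-theoretic) route and does not arise here.

References: [AgasheRibetStein2012] §2.1; [Shimura1971] Prop. 3.64; [DiamondShurman2005]
Prop. 5.5.2(a); [AtkinLehner1970] Thm. 3.
-/

noncomputable section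

open scoped MatrixGroups ModularForm ComplexConjugate Real

open Matrix.SpecialLinearGroup Matrix.GeneralLinearGroup UpperHalfPlane Complex
  CongruenceSubgroup Literature.NumberTheory.EllipticCurves.ModularForms
  Literature.NumberTheory.Automorphic Summit.BirchSwinnertonDyer.Rank1Residual.O5

namespace Summit.BirchSwinnertonDyer.Rank1Residual.ManinAdditive

namespace TwistAtTwo

/-! ### §1 TWIN from a Petersson isometry on `2`-depleted forms -/

section Twin

variable {N m : ℕ} [NeZero N] [NeZero m] {k : ℤ} (hm : m ^ 2 ∣ N) {χ : DirichletCharacter ℂ m}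
  (hχ : χ.IsQuadratic) (hu : ∀ n : ℕ, IsUnit (n : ZMod m) ↔ ¬ 2 ∣ n) (hprim : χ.IsPrimitive)
  (hiso : ∀ f : CuspForm (Gamma0 N) k, (∀ n, 2 ∣ n → cuspCoeff f n = 0) → ∀ x : CuspForm (Gamma0 N) k,
    peterssonProduct (Gamma0 N) k (charTwist N dvd_rfl hm hχ f) (charTwist N dvd_rfl hm hχ x) =
      peterssonProduct (Gamma0 N) k f x)

include hu hprim hiso in
/-- `x − R(R x) ⊥ f` for `2`-depleted `f` and every `x`: `⟨f, RRx⟩ = ⟨Rf, Rx⟩ = ⟨f, x⟩` (isometry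
twice, `RRf = f`). [cite: Shimura1971, Prop. 3.64] -/
theorem peterssonProduct_sub_charTwist_charTwist_eq_zero {f : CuspForm (Gamma0 N) k}
    (hf : ∀ n, 2 ∣ n → cuspCoeff f n = 0) (x : CuspForm (Gamma0 N) k) :
    peterssonProduct (Gamma0 N) k f (x - charTwist N dvd_rfl hm hχ (charTwist N dvd_rfl hm hχ x)) = 0 := by
  have h2 := hiso (charTwist N dvd_rfl hm hχ f)
    (fun n hn ↦ cuspCoeff_charTwist_eq_zero_of_two_dvd hm hχ hu hprim f hn) (charTwist N dvd_rfl hm hχ x)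
  rw [charTwist_charTwist hm hχ hu hprim hf, hiso f hf x] at h2
  rw [sub_eq_add_neg, peterssonProduct_add_right, ← neg_one_smul ℂ (charTwist N dvd_rfl hm hχ _),
    peterssonProduct_smul_right, h2, neg_one_mul, add_neg_cancel]

include hprim hiso in
/-- `R` maps `ℤf + (ℤf)^⊥` into `ℤRf + (ℤRf)^⊥` for `2`-depleted `f`. [cite: AgasheRibetStein2012, §2.1] -/
theorem charTwist_mem_sup {f : CuspForm (Gamma0 N) k} (hf : ∀ n, 2 ∣ n → cuspCoeff f n = 0)
    {x : CuspForm (Gamma0 N) k} (hx : x ∈ (ℤ ∙ f) ⊔ integralOrthogonal0 f) :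
    charTwist N dvd_rfl hm hχ x ∈
      (ℤ ∙ charTwist N dvd_rfl hm hχ f) ⊔ integralOrthogonal0 (charTwist N dvd_rfl hm hχ f) := by
  obtain ⟨a, ha, b, hb, rfl⟩ := Submodule.mem_sup.mp hx
  obtain ⟨z, rfl⟩ := Submodule.mem_span_singleton.mp ha
  rw [mem_integralOrthogonal0] at hb
  rw [charTwist_add hm hχ hprim, charTwist_zsmul hm hχ hprim]
  refine Submodule.add_mem _ (Submodule.mem_sup_left (Submodule.mem_span_singleton.mpr ⟨z, rfl⟩))
    (Submodule.mem_sup_right ?_)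
  rw [mem_integralOrthogonal0]
  refine ⟨charTwist_mem_integralCuspForms0 hm hχ hprim hb.1, ?_⟩
  rw [hiso f hf b, hb.2]

include hu hprim hiso in
/-- `x − R(R x) ∈ ℤf + (ℤf)^⊥` for `2`-depleted `f` and integral `x`. [cite: AgasheRibetStein2012, §2.1] -/
theorem sub_charTwist_charTwist_mem_sup {f : CuspForm (Gamma0 N) k} (hf : ∀ n, 2 ∣ n → cuspCoeff f n = 0)
    {x : CuspForm (Gamma0 N) k} (hx : x ∈ integralCuspForms0 N k) :
    x - charTwist N dvd_rfl hm hχ (charTwist N dvd_rfl hm hχ x) ∈ (ℤ ∙ f) ⊔ integralOrthogonal0 f := by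
  refine Submodule.mem_sup_right ?_
  rw [mem_integralOrthogonal0]
  exact ⟨Submodule.sub_mem _ hx
      (charTwist_mem_integralCuspForms0 hm hχ hprim (charTwist_mem_integralCuspForms0 hm hχ hprim hx)),
    peterssonProduct_sub_charTwist_charTwist_eq_zero hm hχ hu hprim hiso hf x⟩

include hu hprim hiso in
/-- **TWIN FROM AN ISOMETRY.** If the twist by `χ` (primitive quadratic mod `m`, `m² ∣ N`,
units mod `m` = odd residues) is a Petersson isometry on `2`-depleted forms, then
`congruenceNumber (f ⊗ χ) = congruenceNumber f` for every `2`-depleted `f ∈ S_k(Γ₀(N))`: the twist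
induces mutually inverse bijections of the ARS quotients (`R² ≡ id` modulo `(ℤf)^⊥`, `R(R f) = f`).
The O5 proof (`PrimeTwist.congruenceNumber_charTwist`) abstracted over the isometry.
[cite: AgasheRibetStein2012, §2.1] [cite: Shimura1971, Prop. 3.64] -/
theorem congruenceNumber_charTwist_of_isometry {f : CuspForm (Gamma0 N) k}
    (hf : ∀ n, 2 ∣ n → cuspCoeff f n = 0) :
    congruenceNumber (charTwist N dvd_rfl hm hχ f) = congruenceNumber f := by
  set S := integralCuspForms0 N k with hS
  have hRf : ∀ n, 2 ∣ n → cuspCoeff (charTwist N dvd_rfl hm hχ f) n = 0 :=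
    fun n hn ↦ cuspCoeff_charTwist_eq_zero_of_two_dvd hm hχ hu hprim f hn
  let φ : S →ₗ[ℤ] S :=
    { toFun := fun x ↦ ⟨charTwist N dvd_rfl hm hχ x, charTwist_mem_integralCuspForms0 hm hχ hprim x.2⟩
      map_add' := fun x y ↦ Subtype.ext (charTwist_add hm hχ hprim (x : CuspForm (Gamma0 N) k) y)
      map_smul' := fun z x ↦ Subtype.ext (charTwist_zsmul hm hχ hprim z (x : CuspForm (Gamma0 N) k)) }
  have hφ : ∀ x : S, ((φ x : S) : CuspForm (Gamma0 N) k) = charTwist N dvd_rfl hm hχ x := fun _ ↦ rfl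
  set Hf : Submodule ℤ S := ((ℤ ∙ f) ⊔ integralOrthogonal0 f).comap S.subtype with hHf
  set Hg : Submodule ℤ S := ((ℤ ∙ charTwist N dvd_rfl hm hχ f) ⊔
    integralOrthogonal0 (charTwist N dvd_rfl hm hχ f)).comap S.subtype with hHg
  have hle : Hf ≤ Hg.comap φ := by
    intro x hx
    rw [Submodule.mem_comap, hHg, Submodule.mem_comap, Submodule.subtype_apply, hφ]
    rw [hHf, Submodule.mem_comap, Submodule.subtype_apply] at hx
    exact charTwist_mem_sup hm hχ hprim hiso hf hx
  let ψ : (S ⧸ Hf) →ₗ[ℤ] (S ⧸ Hg) := Hf.mapQ Hg φ hle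
  have hψ : ∀ x : S, ψ (Submodule.Quotient.mk x) = Submodule.Quotient.mk (φ x) := fun _ ↦ rfl
  have hinj : Function.Injective ψ := by
    rw [← LinearMap.ker_eq_bot, LinearMap.ker_eq_bot']
    intro q hq
    obtain ⟨x, rfl⟩ := Submodule.Quotient.mk_surjective Hf q
    rw [hψ, Submodule.Quotient.mk_eq_zero, hHg, Submodule.mem_comap, Submodule.subtype_apply, hφ] at hq
    rw [Submodule.Quotient.mk_eq_zero, hHf, Submodule.mem_comap, Submodule.subtype_apply]
    have h2 := charTwist_mem_sup hm hχ hprim hiso hRf hq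
    rw [charTwist_charTwist hm hχ hu hprim hf] at h2
    have h3 := sub_charTwist_charTwist_mem_sup hm hχ hu hprim hiso hf x.2
    simpa using Submodule.add_mem _ h3 h2
  have hsurj : Function.Surjective ψ := by
    intro q
    obtain ⟨y, rfl⟩ := Submodule.Quotient.mk_surjective Hg q
    refine ⟨Submodule.Quotient.mk (φ y), ?_⟩
    rw [hψ, Submodule.Quotient.eq, hHg, Submodule.mem_comap, Submodule.subtype_apply]
    have h' := sub_charTwist_charTwist_mem_sup hm hχ hu hprim hiso hRf y.2
    have := Submodule.neg_mem _ h'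
    simpa [hφ, neg_sub] using this
  rw [congruenceNumber_def, congruenceNumber_def]
  exact (Nat.card_congr (Equiv.ofBijective ψ ⟨hinj, hsurj⟩)).symm

end Twin

/-! ### §2 TWIN at conductor `4` (`16 ∣ N`) and `8` (`64 ∣ N`) -/

section Instances

variable {N : ℕ} [NeZero N] {k : ℤ}

/-- **TWIN at conductor 4: `congruenceNumber (f ⊗ χ₋₄) = congruenceNumber f`** for every
`2`-depleted `f ∈ S_k(Γ₀(N))`, `16 ∣ N`. [cite: AgasheRibetStein2012, §2.1] [cite: Shimura1971, Prop. 3.64] -/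
theorem congruenceNumber_charTwist_four (h16 : 4 ^ 2 ∣ N) {χ : DirichletCharacter ℂ 4}
    (hχ : χ.IsQuadratic) (hprim : χ.IsPrimitive) {f : CuspForm (Gamma0 N) k}
    (hf : ∀ n, 2 ∣ n → cuspCoeff f n = 0) :
    congruenceNumber (charTwist N dvd_rfl h16 hχ f) = congruenceNumber f :=
  congruenceNumber_charTwist_of_isometry h16 hχ isUnit_natCast_zmod_four_iff hprim
    (fun _ hg x ↦ peterssonProduct_charTwist_charTwist_four h16 hχ hprim hg x) hf

/-- **TWIN at conductor 8: `congruenceNumber (f ⊗ χ) = congruenceNumber f`** for `χ ∈ {χ₈, χ₋₈}`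
(`χ(5) = −1`), every `2`-depleted `f ∈ S_k(Γ₀(N))`, `64 ∣ N`.
[cite: AgasheRibetStein2012, §2.1] [cite: Shimura1971, Prop. 3.64] -/
theorem congruenceNumber_charTwist_eight (h64 : 8 ^ 2 ∣ N) {χ : DirichletCharacter ℂ 8}
    (hχ : χ.IsQuadratic) (hprim : χ.IsPrimitive) (h5 : χ 5 = -1) {f : CuspForm (Gamma0 N) k}
    (hf : ∀ n, 2 ∣ n → cuspCoeff f n = 0) :
    congruenceNumber (charTwist N dvd_rfl h64 hχ f) = congruenceNumber f :=
  congruenceNumber_charTwist_of_isometry h64 hχ isUnit_natCast_zmod_eight_iff hprim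
    (fun _ hg x ↦ peterssonProduct_charTwist_charTwist_eight h64 hχ hprim h5 hg x) hf

/-- A newform of level `N` with `4 ∣ N` is `2`-depleted (`a₂ = 0`, `a_{2m} = a₂ aₘ`).
[cite: AtkinLehner1970, Thm. 3] -/
theorem cuspCoeff_eq_zero_of_two_dvd_of_isNewform0 (h4 : 2 ^ 2 ∣ N) {f : CuspForm (Gamma0 N) k}
    (hf : IsNewform0 f) {n : ℕ} (hn : 2 ∣ n) : cuspCoeff f n = 0 :=
  PrimeTwist.cuspCoeff_eq_zero_of_prime_dvd_of_isNewform0 h4 hf hn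

/-- **TWIN for newforms at conductor 4** (`16 ∣ N`). [cite: AgasheRibetStein2012, §2.1] -/
theorem congruenceNumber_charTwist_four_of_isNewform0 (h16 : 4 ^ 2 ∣ N) {χ : DirichletCharacter ℂ 4}
    (hχ : χ.IsQuadratic) (hprim : χ.IsPrimitive) {f : CuspForm (Gamma0 N) k} (hf : IsNewform0 f) :
    congruenceNumber (charTwist N dvd_rfl h16 hχ f) = congruenceNumber f :=
  congruenceNumber_charTwist_four h16 hχ hprim fun _ hn ↦
    cuspCoeff_eq_zero_of_two_dvd_of_isNewform0 ((show 2 ^ 2 ∣ 4 ^ 2 by norm_num).trans h16) hf hn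

/-- **TWIN for newforms at conductor 8** (`64 ∣ N`, `χ(5) = −1`). [cite: AgasheRibetStein2012, §2.1] -/
theorem congruenceNumber_charTwist_eight_of_isNewform0 (h64 : 8 ^ 2 ∣ N) {χ : DirichletCharacter ℂ 8}
    (hχ : χ.IsQuadratic) (hprim : χ.IsPrimitive) (h5 : χ 5 = -1) {f : CuspForm (Gamma0 N) k}
    (hf : IsNewform0 f) : congruenceNumber (charTwist N dvd_rfl h64 hχ f) = congruenceNumber f :=
  congruenceNumber_charTwist_eight h64 hχ hprim h5 fun _ hn ↦
    cuspCoeff_eq_zero_of_two_dvd_of_isNewform0 ((show 2 ^ 2 ∣ 8 ^ 2 by norm_num).trans h64) hf hn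

end Instances

end TwistAtTwo

end Summit.BirchSwinnertonDyer.Rank1Residual.ManinAdditive
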